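import Summits.QuantumFields.BalabanUV.T4Continuum.Support.NE7RepWGaugeOfRoutePi
import HarnessLib

/-!
# Support | NE7 (F326): THE HONEST PER-PAIR BINDER OF THE ONE-STEP CHAIN — the DECOMPOSITION `X = X_T + X_N` WITH ITS TWO ENERGY LETTERS AND
# k-FREE CURRENCIES (`hdecomp`) — and the route-Π supplier through DIRECT ℓ²∕ℓ¹ LETTERS of the linearised average; the WEIGHT CURRENCY of
# F30 ∕ F31 … F324 (`M^dΣm² ≤ C²·dirSq X₀` + `‖D X₀(z,κ)‖ ≤ C₂(Mm)²`) is RETIRED (numerically refuted for arbitrary pairs, memo WEIGHT-CURRENCY-DEAD)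

Cell `pub-balaban`, rung (B)+1 sub-cell t4, lineage `b2b-balaban-t4-ne7-p1` (CRUX PROVER NE7 #1 = OWNER of row NE7), generation 95; memo
`t4/b2b-balaban-t4-ne7-p1-g95/WEIGHT-CURRENCY-DEAD.md`.  Over F30 `NE7RepWGaugeOfRoutePi` (§§1–3 reused BY NAME: `sub_mem_frameFreeBlockLandauW_symm`,
`line_of_kfree_line`) and row NE3's right-inverse letters `NE3RightInverseLetters` ((R1)–(R3)).

WHY.  The per-pair binder `hleaves` threaded from F30 ∕ F31 (`NE7OneStepOfRoutePi`) to the END OF RECORD F324 (`NE7HintOfSliceNormalisationSU2`) asks, besides the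
residual slice representative, a WEIGHT `m` with `M^d·Σ_{periodBox N} m² ≤ C²·dirSq X₀` and the blockwise quadratic letter `‖dirIter L (k+1) U♯ X₀ (z,κ)‖ ≤ C₂(M·m(z,κ))²`,
`C ≤ Ĉ`, `C₂` k-FREE.  Together these force `dirL1 (dirIter … X₀) (periodBox N) ≤ C₂Ĉ²·M^{2−d}·dirSq X₀`.  On the fibre `dirIter … X₀ = −C(X₀)` (the quadratic remainder),
and for a NON-ABELIAN `X₀` localised at a top-block CORNER the remainder's corner cross term is carried to the top by the frames (`dirIter = QbarIter + gaugeDir∘framePotW`)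
WITHOUT decay: numerically (kit jobs j332481 ∕ j332484, the tree's average (42) verbatim at the flat background, SU(2), `N = 2`) the second-order response of the top
average to a unit corner-localised divergence-free tangent field is `0.171` (d = 3, M = 4 … 64) and `0.0140` (d = 4, M = 4 … 16), M-INDEPENDENT, while the same field
in the bulk gives `∝ M^{1−d}` and an abelian field gives `0` exactly.  So the weight currency is NOT dischargeable for arbitrary admissible `U′` (its allowance shrinks like
`M^{2−d}`), although F29's `hrep` — the interface the chain actually CONSUMES — only needs the two ENERGY letters of the normal part, which the same families pass.
THIS FILE therefore installs the honest binder: §1 **`hdecomp`-shape ⟹ F29's `hrep` body** (`hrep_body_of_decomp`, `hrep_of_hdecomp`): per pair a unitary site gauge `u`,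
`U′^{u} = U♯·e^{X}`, `X = X_T + X_N`, `X_T ∈ T_♮(U♯)`, `‖X_N‖_w ≤ ν‖X‖_w`, `(ε∕M²)·Σ_{perWin}‖curl_{U♯} X_N‖ ≤ κ‖X‖_w²`, and k-FREE CURRENCIES `sup‖X‖·M ≤ α̂`,
`ν ≤ ν̂`, `κ ≤ κ̂`; uniformly ONE k-free strict line in `(α̂, ν̂, κ̂, ε, CP)` (F30's, with `ν̂, κ̂` now free letters).  §2 **THE ROUTE-Π SUPPLIER THROUGH DIRECT LETTERS**
(`decomp_of_directLetters`): the exact residual slice representative `ResidualSliceRepT … (rightInvW …(D X₀)) α₀` plus the two DIRECT letters of `φ := dirIter L (k+1) U♯ X₀`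
— (DL2) `(M^d∕M⁴)·dirSq φ (periodBox N) ≤ q₂²·‖X₀‖_w²`, (DL1) `(M^d∕M⁴)·dirL1 φ (periodBox N) ≤ q₁·‖X₀‖_w²` (`‖·‖_w = energyNormW L (k+1) U♯ · (periodBox (N·M))`) — give
the `hdecomp` body with `X_N := rightInvW …(φ)`, `ν := √(c₁+c₂)·q₂`, `κ := ε·c₃·q₁` (`c₁ = l2C∕(1−θℓ)²`, `c₂ = curl2C∕(1−θℓ)²`, `c₃ = curl1C∕(1−θℓ)`, `θℓ = thetaLoc·ε`), by
(R1)–(R3).  In `d = 4` the direct letters read `dirSq φ ≤ q₂²(curlSq X₀ + M⁻²dirSq X₀)`, `dirL1 φ ≤ q₁(curlSq X₀ + M⁻²dirSq X₀)` — they KEEP the curl energy that the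
weight currency threw away, and hold on the corner family with `q₁ ≈ 0.007`.
HONEST FRAMING (page 1): bookkeeping and real arithmetic over landed theorems; the decomposition, the direct letters and the numeric line are HYPOTHESIS SHAPES asserted for
nothing; nothing of Bałaban's asserted; NOT ONE-STEP, NOT NE7; spine 0∕9; finite T⁴ rung (B)+1 — NOT infinite volume, NOT mass gap, NOT `BetaPertH`, NOT Clay.  Continuum YM
on T⁴ ⇐ BetaPertH ∧ nine spine estimates (0/9 proved); BetaPertH ⇐ (D1) ∧ (D4) ∧ CAP+tail; G-an2-4 gates asym, D1 and NE2/3/4.  0 def, 0 sorry.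
-/

set_option autoImplicit false

open scoped BigOperators Matrix Matrix.Norms.L2Operator
open NormedSpace Finset Set

namespace Summit.QuantumFields.BalabanUV.T4Continuum.NE7RepWGaugeOfDecomposition

open Literature.MathematicalPhysics.QuantumFieldTheory.Balaban1983to89
open B7Prop1Explicit B7Prop2Explicit
open T4AveragingDeficitWall (IsUnitaryCfg IsSkewDir SmallField vary curl curlSq dirSq dirL1)
open T4AveragingDeficitWallBoundary (IsPeriodicCfg periodBox)
open AveragingDeficitPeriodicCounting (IsPeriodicDir)
open AveragingDeficitMultiLevelPrep (LevelSmall tower TangentIter)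
open MinimalActionLevels (perWin)
open MinimalActionSandwich (admissible)
open MinimalActionRate (sfClass)
open NE3EnergyShapes (IsUnitarySite IsPeriodicSite)
open NE3EnergyWeightedShapes (energyNormW energyNormW_nonneg)
open NE3ProductPathBounds (energySq_nonneg)
open NE3EnergyHessContTwoTerm (curlSq_nonneg dirSq_nonneg)
open NE3TangentCovariantTower (dirIter)
open NE3FrameFreeSliceW (frameFreeBlockLandauW)
open NE3DecomposedRepOfLinearNormalPart (ResidualSliceRepT)
open NE3DecomposedRepSfClass (levelRadius_rescale)
open NE3QbarIterCovLiftPrep (cruxC)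
open NE3SmoothRightInverseW (rightInvW)
open NE3RightInverseSolveLetters (thetaLoc cruxC_nonneg cruxC_le_thetaLoc)
open NE3RightInverseL2Letter (l2C l2C_nonneg)
open NE3HatInvCurlLetters (curl2C curl1C curl2C_nonneg curl1C_nonneg)
open NE3RightInverseLetters (rightInvW_R1 curlSq_rightInvW_le sum_norm_curl_rightInvW_le)
open NE3EnergyRateWSupRoutePiRInv (dirIter_skew)
open NE7RepWGaugeOfRoutePi (sub_mem_frameFreeBlockLandauW_symm line_of_kfree_line)

noncomputable section

variable {d : ℕ} {n : Type*} [Fintype n] [DecidableEq n]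

/-! ## §1 The honest per-pair binder `hdecomp` gives F29's `hrep` body -/

omit [DecidableEq n] in
/-- **THE LINE IS MONOTONE IN THE LETTERS**: `0 ≤ ν ≤ ν̂`, `κ ≤ κ̂`, `0 < 1 + CP`, `0 < card n` turn the k-free line at `(ν̂, κ̂)` into the one at `(ν, κ)`. [folklore] -/
theorem kfree_line_mono {αh ε ν νh κ κh CP : ℝ} (hν0 : 0 ≤ ν) (hν : ν ≤ νh) (hκ : κ ≤ κh) (hCP : 0 < 1 + CP)
    (hcard : 0 < (Fintype.card n : ℝ))
    (hline : 2 * κh < ((((1 / 2 - νh ^ 2) / (2 * (1 + CP)) - νh ^ 2) / 2 - 576 * d * (αh ^ 2 * Real.exp (2 * αh))) / (Fintype.card n : ℝ)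
        - 28 * d * (ε + 7 * αh ^ 2))) :
    2 * κ < ((((1 / 2 - ν ^ 2) / (2 * (1 + CP)) - ν ^ 2) / 2 - 576 * d * (αh ^ 2 * Real.exp (2 * αh))) / (Fintype.card n : ℝ)
        - 28 * d * (ε + 7 * αh ^ 2)) := by
  have h1 : ν ^ 2 ≤ νh ^ 2 := pow_le_pow_left₀ hν0 hν 2
  have h2 : (1 / 2 - νh ^ 2) / (2 * (1 + CP)) ≤ (1 / 2 - ν ^ 2) / (2 * (1 + CP)) :=
    div_le_div_of_nonneg_right (by linarith) (by linarith)
  have h3 : (((1 / 2 - νh ^ 2) / (2 * (1 + CP)) - νh ^ 2) / 2 - 576 * d * (αh ^ 2 * Real.exp (2 * αh))) / (Fintype.card n : ℝ)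
      ≤ (((1 / 2 - ν ^ 2) / (2 * (1 + CP)) - ν ^ 2) / 2 - 576 * d * (αh ^ 2 * Real.exp (2 * αh))) / (Fintype.card n : ℝ) :=
    div_le_div_of_nonneg_right (by linarith) hcard.le
  linarith

/-- **F29's `hrep` BODY FROM THE DECOMPOSITION DATA WITH k-FREE CURRENCIES** (level `k+1`, `M = L^{k+1}`, `L ≥ 1`): `u` unitary, `X` skew `(N·M)`-periodic
with `sup ≤ α`, `U′^{u} = U♯·e^{X}`, `X = X_T + X_N`, `X_T ∈ T_♮(U♯)`, `X_N` skew, `‖X_N‖_w ≤ ν‖X‖_w`, `(ε∕M²)·Σ‖curl X_N‖ ≤ κ‖X‖_w²`, currencies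
`αM ≤ α̂`, `0 ≤ ν ≤ ν̂`, `κ ≤ κ̂`, and the k-free line at `(α̂, ν̂, κ̂)` ⟹ the `hrep` body with the per-level line at `(α, ν, κ)`. [folklore] -/
theorem hrep_body_of_decomp {L N : ℕ} (hL : 1 ≤ L) (k : ℕ) {ε αh νh κh CP : ℝ} (hCP : 0 < 1 + CP) (hcard : 0 < (Fintype.card n : ℝ))
    (hline : 2 * κh < ((((1 / 2 - νh ^ 2) / (2 * (1 + CP)) - νh ^ 2) / 2 - 576 * d * (αh ^ 2 * Real.exp (2 * αh))) / (Fintype.card n : ℝ)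
        - 28 * d * (ε + 7 * αh ^ 2)))
    {Us U' : Site d → Fin d → (Matrix n n ℂ)ˣ} {u : Site d → (Matrix n n ℂ)ˣ} {X XT XN : Site d → Fin d → Matrix n n ℂ} {α ν κ : ℝ}
    (hu : IsUnitarySite u) (hXs : IsSkewDir X) (hXP : IsPeriodicDir X ((N * L ^ (k + 1) : ℕ) : ℤ)) (hα : 0 ≤ α) (hsup : ∀ x μ, ‖X x μ‖ ≤ α)
    (hrep : gaugeAct u U' = vary Us X 1) (hX : X = XT + XN) (hT : XT ∈ frameFreeBlockLandauW (d := d) (n := n) L N (k + 1) Us) (hNs : IsSkewDir XN)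
    (hν0 : 0 ≤ ν)
    (hN1 : energyNormW L (k + 1) Us XN (periodBox (d := d) (N * L ^ (k + 1))) ≤ ν * energyNormW L (k + 1) Us X (periodBox (d := d) (N * L ^ (k + 1))))
    (hN2 : ε / ((L : ℝ) ^ (k + 1)) ^ 2 * (∑ p ∈ perWin d (N * L ^ (k + 1)), ‖curl Us XN p‖)
      ≤ κ * energyNormW L (k + 1) Us X (periodBox (d := d) (N * L ^ (k + 1))) ^ 2)
    (hcur : α * (L : ℝ) ^ (k + 1) ≤ αh) (hνh : ν ≤ νh) (hκh : κ ≤ κh) :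
    ∃ (u : Site d → (Matrix n n ℂ)ˣ) (X XT XN : Site d → Fin d → Matrix n n ℂ) (α ν κ₁ : ℝ),
      IsUnitarySite u ∧ IsSkewDir X ∧ IsPeriodicDir X ((N * L ^ (k + 1) : ℕ) : ℤ) ∧ 0 ≤ α ∧ (∀ x μ, ‖X x μ‖ ≤ α) ∧
      gaugeAct u U' = vary Us X 1 ∧
      X = XT + XN ∧ XT ∈ frameFreeBlockLandauW (d := d) (n := n) L N (k + 1) Us ∧ IsSkewDir XN ∧ 0 ≤ ν ∧
      energyNormW L (k + 1) Us XN (periodBox (d := d) (N * L ^ (k + 1)))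
        ≤ ν * energyNormW L (k + 1) Us X (periodBox (d := d) (N * L ^ (k + 1))) ∧
      ε / ((L : ℝ) ^ (k + 1)) ^ 2 * (∑ p ∈ perWin d (N * L ^ (k + 1)), ‖curl Us XN p‖)
        ≤ κ₁ * energyNormW L (k + 1) Us X (periodBox (d := d) (N * L ^ (k + 1))) ^ 2 ∧
      2 * κ₁ < ((((1 / 2 - ν ^ 2) / (2 * (1 + CP)) - ν ^ 2) / 2
          - 576 * d * (Real.exp α - 1) ^ 2 * ((L : ℝ) ^ (k + 1)) ^ 2) / (Fintype.card n : ℝ)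
          - 28 * d * (ε / ((L : ℝ) ^ (k + 1)) ^ 2 + 7 * α ^ 2) * ((L : ℝ) ^ (k + 1)) ^ 2) := by
  have hl1 := kfree_line_mono (n := n) (d := d) (αh := αh) (ε := ε) hν0 hνh hκh hCP hcard hline
  have hl2 := line_of_kfree_line (n := n) (d := d) hL k hα hcur hcard hl1
  exact ⟨u, X, XT, XN, α, ν, κ, hu, hXs, hXP, hα, hsup, hrep, hX, hT, hNs, hν0, hN1, hN2, hl2⟩

/-- **THE `hrep` BINDER OF THE ONE-STEP END (F28 ∕ F29) FROM THE HONEST PER-PAIR BINDER `hdecomp`** over any data class `𝒟` and side conditions `P k D U♯`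
(`L ≥ 1`, `0 < 1 + CP`; uniformly ONE k-free strict line at the ceilings `(α̂, ν̂, κ̂)`): per pair `(U♯, U′)` the decomposition with its two energy letters and
the currencies `sup‖X‖·L^{k+1} ≤ α̂`, `ν ≤ ν̂`, `κ ≤ κ̂`. [folklore] -/
theorem hrep_of_hdecomp [Nonempty n] {L N : ℕ} (hL : 1 ≤ L) {ε αh νh κh CP : ℝ} (hCP : 0 < 1 + CP)
    (hline : 2 * κh < ((((1 / 2 - νh ^ 2) / (2 * (1 + CP)) - νh ^ 2) / 2 - 576 * d * (αh ^ 2 * Real.exp (2 * αh))) / (Fintype.card n : ℝ)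
        - 28 * d * (ε + 7 * αh ^ 2)))
    {𝒞 : ℕ → Set (Site d → Fin d → (Matrix n n ℂ)ˣ)}
    {𝒟 : Set (Site d → Fin d → (Matrix n n ℂ)ˣ)} {P : ℕ → (Site d → Fin d → (Matrix n n ℂ)ˣ) → (Site d → Fin d → (Matrix n n ℂ)ˣ) → Prop}
    (hdecomp : ∀ D ∈ 𝒟, ∀ (k : ℕ), ∀ Us ∈ admissible 𝒞 L (k + 1) D, P k D Us →
      ∀ U' ∈ admissible 𝒞 L (k + 1) D,
      ∃ (u : Site d → (Matrix n n ℂ)ˣ) (X XT XN : Site d → Fin d → Matrix n n ℂ) (α ν κ : ℝ),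
        IsUnitarySite u ∧ IsSkewDir X ∧ IsPeriodicDir X ((N * L ^ (k + 1) : ℕ) : ℤ) ∧ 0 ≤ α ∧ (∀ x μ, ‖X x μ‖ ≤ α) ∧
        gaugeAct u U' = vary Us X 1 ∧
        X = XT + XN ∧ XT ∈ frameFreeBlockLandauW (d := d) (n := n) L N (k + 1) Us ∧ IsSkewDir XN ∧ 0 ≤ ν ∧
        energyNormW L (k + 1) Us XN (periodBox (d := d) (N * L ^ (k + 1)))
          ≤ ν * energyNormW L (k + 1) Us X (periodBox (d := d) (N * L ^ (k + 1))) ∧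
        ε / ((L : ℝ) ^ (k + 1)) ^ 2 * (∑ p ∈ perWin d (N * L ^ (k + 1)), ‖curl Us XN p‖)
          ≤ κ * energyNormW L (k + 1) Us X (periodBox (d := d) (N * L ^ (k + 1))) ^ 2 ∧
        α * (L : ℝ) ^ (k + 1) ≤ αh ∧ ν ≤ νh ∧ κ ≤ κh) :
    ∀ D ∈ 𝒟, ∀ (k : ℕ), ∀ Us ∈ admissible 𝒞 L (k + 1) D, P k D Us →
      ∀ U' ∈ admissible 𝒞 L (k + 1) D, ∃ (u : Site d → (Matrix n n ℂ)ˣ) (X XT XN : Site d → Fin d → Matrix n n ℂ)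
        (α ν κ₁ : ℝ), IsUnitarySite u ∧ IsSkewDir X ∧ IsPeriodicDir X ((N * L ^ (k + 1) : ℕ) : ℤ) ∧ 0 ≤ α ∧ (∀ x μ, ‖X x μ‖ ≤ α) ∧
        gaugeAct u U' = vary Us X 1 ∧
        X = XT + XN ∧ XT ∈ frameFreeBlockLandauW (d := d) (n := n) L N (k + 1) Us ∧ IsSkewDir XN ∧ 0 ≤ ν ∧
        energyNormW L (k + 1) Us XN (periodBox (d := d) (N * L ^ (k + 1)))
          ≤ ν * energyNormW L (k + 1) Us X (periodBox (d := d) (N * L ^ (k + 1))) ∧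
        ε / ((L : ℝ) ^ (k + 1)) ^ 2 * (∑ p ∈ perWin d (N * L ^ (k + 1)), ‖curl Us XN p‖)
          ≤ κ₁ * energyNormW L (k + 1) Us X (periodBox (d := d) (N * L ^ (k + 1))) ^ 2 ∧
        2 * κ₁ < ((((1 / 2 - ν ^ 2) / (2 * (1 + CP)) - ν ^ 2) / 2
            - 576 * d * (Real.exp α - 1) ^ 2 * ((L : ℝ) ^ (k + 1)) ^ 2) / (Fintype.card n : ℝ)
            - 28 * d * (ε / ((L : ℝ) ^ (k + 1)) ^ 2 + 7 * α ^ 2) * ((L : ℝ) ^ (k + 1)) ^ 2) := by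
  intro D hD k Us hUs hP U' hU'
  obtain ⟨u, X, XT, XN, α, ν, κ, hu, hXs, hXP, hα, hsup, hrep, hX, hT, hNs, hν0, hN1, hN2, hcur, hνh, hκh⟩ :=
    hdecomp D hD k Us hUs hP U' hU'
  have hcard : 0 < (Fintype.card n : ℝ) := by exact_mod_cast Fintype.card_pos
  exact hrep_body_of_decomp hL k hCP hcard hline hu hXs hXP hα hsup hrep hX hT hNs hν0 hN1 hN2 hcur hνh hκh

/-! ## §2 The route-Π supplier through the DIRECT letters of the linearised average -/

/-- **THE `hdecomp` BODY FROM THE EXACT RESIDUAL SLICE REPRESENTATIVE AND THE TWO DIRECT LETTERS** (level `k+1`, `M = L^{k+1}`, `U♯ ∈ sfClass d L N ε (k+1)`,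
`LevelSmall d L k (ε∕M²)`, W6 regime `thetaLoc·ε < 1`, `ε ≤ 1`).  PER PAIR: `ResidualSliceRepT L N (k+1) U♯ U′ u X₀ (rightInvW …(φ)) α₀` for every proof argument of
`rightInvW`, `φ := dirIter L (k+1) U♯ X₀`, and the DIRECT LETTERS (DL2) `(M^d∕M⁴)·dirSq φ (periodBox N) ≤ q₂²·‖X₀‖_w²`, (DL1) `(M^d∕M⁴)·dirL1 φ (periodBox N) ≤ q₁·‖X₀‖_w²`
(`q₂ ≥ 0`).  CONCLUSION: the decomposition `X := X₀ = (X₀ − X_N) + X_N`, `X_N := rightInvW …(φ)`, with `‖X_N‖_w ≤ √(c₁+c₂)·q₂·‖X₀‖_w` and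
`(ε∕M²)·Σ‖curl X_N‖ ≤ (ε·c₃·q₁)·‖X₀‖_w²` — the normal sizes are THEOREMS of (R1)–(R3). [folklore] -/
theorem decomp_of_directLetters [Nonempty n] {L N : ℕ} [NeZero L] [NeZero N] (hL : 2 ≤ L) (k : ℕ) {ε : ℝ} (hε : 0 < ε)
    (hls : LevelSmall d L k (ε / ((L : ℝ) ^ (k + 1)) ^ 2)) (hθl : thetaLoc d L * ε < 1) (hε1 : ε ≤ 1)
    {Us U' : Site d → Fin d → (Matrix n n ℂ)ˣ} (hUs : Us ∈ sfClass d L N ε (k + 1))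
    {u : Site d → (Matrix n n ℂ)ˣ} {X₀ : Site d → Fin d → Matrix n n ℂ} {α₀ q₂ q₁ : ℝ} (hq₂ : 0 ≤ q₂)
    (hXs : IsSkewDir X₀)
    (hrep : ∀ (hWu : IsUnitaryCfg Us) (hx : 0 ≤ ε / ((L : ℝ) ^ (k + 1)) ^ 2) (hs : LevelSmall d L k (ε / ((L : ℝ) ^ (k + 1)) ^ 2))
        (hWx : SmallField Us (ε / ((L : ℝ) ^ (k + 1)) ^ 2))
        (hθ : cruxC d L * (((L : ℝ) ^ (k + 1)) ^ 2 * (ε / ((L : ℝ) ^ (k + 1)) ^ 2)) < 1)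
        (hφ : IsSkewDir (dirIter L (k + 1) Us X₀)),
      ResidualSliceRepT L N (k + 1) Us U' u X₀ (rightInvW hL k hWu hx hs hWx N hθ hφ) α₀)
    (hDL2 : ((L : ℝ) ^ (k + 1)) ^ d / ((L : ℝ) ^ (k + 1)) ^ 4 * dirSq (dirIter L (k + 1) Us X₀) (periodBox (d := d) N)
      ≤ q₂ ^ 2 * energyNormW L (k + 1) Us X₀ (periodBox (d := d) (N * L ^ (k + 1))) ^ 2)
    (hDL1 : ((L : ℝ) ^ (k + 1)) ^ d / ((L : ℝ) ^ (k + 1)) ^ 4 * dirL1 (dirIter L (k + 1) Us X₀) (periodBox (d := d) N)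
      ≤ q₁ * energyNormW L (k + 1) Us X₀ (periodBox (d := d) (N * L ^ (k + 1))) ^ 2) :
    ∃ (u : Site d → (Matrix n n ℂ)ˣ) (X XT XN : Site d → Fin d → Matrix n n ℂ) (α ν κ : ℝ),
      IsUnitarySite u ∧ IsSkewDir X ∧ IsPeriodicDir X ((N * L ^ (k + 1) : ℕ) : ℤ) ∧ 0 ≤ α ∧ (∀ x μ, ‖X x μ‖ ≤ α) ∧
      gaugeAct u U' = vary Us X 1 ∧
      X = XT + XN ∧ XT ∈ frameFreeBlockLandauW (d := d) (n := n) L N (k + 1) Us ∧ IsSkewDir XN ∧ 0 ≤ ν ∧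
      energyNormW L (k + 1) Us XN (periodBox (d := d) (N * L ^ (k + 1)))
        ≤ ν * energyNormW L (k + 1) Us X (periodBox (d := d) (N * L ^ (k + 1))) ∧
      ε / ((L : ℝ) ^ (k + 1)) ^ 2 * (∑ p ∈ perWin d (N * L ^ (k + 1)), ‖curl Us XN p‖)
        ≤ κ * energyNormW L (k + 1) Us X (periodBox (d := d) (N * L ^ (k + 1))) ^ 2 ∧
      α = α₀ ∧
      ν = Real.sqrt (l2C d L / (1 - thetaLoc d L * ε) ^ 2 + curl2C d L / (1 - thetaLoc d L * ε) ^ 2) * q₂ ∧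
      κ = ε * (curl1C d L / (1 - thetaLoc d L * ε)) * q₁ := by
  have hL1 : 1 ≤ L := by omega
  have hL1r : (1 : ℝ) ≤ L := by exact_mod_cast hL1
  -- the W6 regime numerics and the route-Π constants
  have hθc : cruxC d L * ε < 1 := lt_of_le_of_lt (mul_le_mul_of_nonneg_right (cruxC_le_thetaLoc d L) hε.le) hθl
  have h1θl : 0 < 1 - thetaLoc d L * ε := by linarith
  set c₁ : ℝ := l2C d L / (1 - thetaLoc d L * ε) ^ 2 with hc₁def
  set c₂ : ℝ := curl2C d L / (1 - thetaLoc d L * ε) ^ 2 with hc₂def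
  set c₃ : ℝ := curl1C d L / (1 - thetaLoc d L * ε) with hc₃def
  have hc₁ : 0 ≤ c₁ := by have := l2C_nonneg d L; positivity
  have hc₂ : 0 ≤ c₂ := by have := curl2C_nonneg d L; positivity
  have hc₃ : 0 ≤ c₃ := by have := curl1C_nonneg d L; positivity
  -- class data of `U♯` and the radius identities
  obtain ⟨hWu, hWP, hWx⟩ := hUs
  have hT : ((tower L N (k + 1) : ℕ) : ℤ) = ((N * L ^ (k + 1) : ℕ) : ℤ) := by
    rw [NE3FramePotBoundW.tower_eq_pow_mul, Nat.mul_comm]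
  have hWPt : IsPeriodicCfg Us ((tower L N (k + 1) : ℕ) : ℤ) := by rw [hT]; exact hWP
  have hx : 0 ≤ ε / ((L : ℝ) ^ (k + 1)) ^ 2 := by positivity
  have hxM : ((L : ℝ) ^ (k + 1)) ^ 2 * (ε / ((L : ℝ) ^ (k + 1)) ^ 2) = ε := (levelRadius_rescale hL1 ε k).2
  set M : ℝ := (L : ℝ) ^ (k + 1) with hMdef
  have hM0 : 0 < M := by positivity
  have hθ : cruxC d L * (M ^ 2 * (ε / M ^ 2)) < 1 := by rw [hxM]; exact hθc
  have hθlM : thetaLoc d L * (M ^ 2 * (ε / M ^ 2)) < 1 := by rw [hxM]; exact hθl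
  have hεM : M ^ 2 * (ε / M ^ 2) ≤ 1 := by rw [hxM]; exact hε1
  -- the coarse datum `φ`
  have hφs : IsSkewDir (dirIter L (k + 1) Us X₀) := dirIter_skew hL1 k hWu hx hls hWx hXs
  have h := hrep hWu hx hls hWx hθ hφs
  -- the letters (R1)–(R3) of `Nn := rightInvW … φ`
  have hR1 := rightInvW_R1 hL k hWu hWPt hx hls hWx hθ hθlM hεM hφs
  have hR2 := curlSq_rightInvW_le hL k hWu hWPt hx hls hWx hθ hθlM hεM hφs
  have hR3 := sum_norm_curl_rightInvW_le hL k hWu hWPt hx hls hWx hθ hθlM hεM hφs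
  rw [hxM] at hR1 hR2 hR3
  set Nn := rightInvW hL k hWu hx hls hWx N hθ hφs with hNndef
  set F := periodBox (d := d) (N * L ^ (k + 1)) with hF
  set φ := dirIter L (k + 1) Us X₀ with hφdef
  -- the slice part and skewness of `Nn`
  have hTm : (fun y μ => X₀ y μ - Nn y μ) ∈ frameFreeBlockLandauW (d := d) (n := n) L N (k + 1) Us :=
    sub_mem_frameFreeBlockLandauW_symm hL1 k hWu hx hls hWx h.tangent
  have hTsk : IsSkewDir (fun y μ => Nn y μ - X₀ y μ) := h.tangent.1
  have hNsk : IsSkewDir Nn := fun y μ => by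
    have e : Nn y μ = (Nn y μ - X₀ y μ) + X₀ y μ := (sub_add_cancel _ _).symm
    rw [e]; exact (skewAdjoint (Matrix n n ℂ)).add_mem (hTsk y μ) (h.skew y μ)
  -- energies
  set EX : ℝ := energyNormW L (k + 1) Us X₀ F with hEX
  set EN : ℝ := energyNormW L (k + 1) Us Nn F with hEN
  have hEX0 : 0 ≤ EX := energyNormW_nonneg _ _ _ _ _
  have hEN0 : 0 ≤ EN := energyNormW_nonneg _ _ _ _ _
  have hdφ0 : 0 ≤ dirSq φ (periodBox (d := d) N) := dirSq_nonneg _ _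
  -- (DL2) ⇒ `EN² ≤ (c₁+c₂)·(M^d/M⁴)·dirSq φ ≤ (c₁+c₂) q₂² EX²`
  have hENsq : EN ^ 2 = curlSq Us Nn F + (M⁻¹) ^ 2 * dirSq Nn F := by
    rw [hEN]; unfold NE3EnergyWeightedShapes.energyNormW
    rw [Real.sq_sqrt (energySq_nonneg L (k + 1) Us Nn F)]
  have hEN2 : EN ^ 2 ≤ (c₁ + c₂) * (q₂ ^ 2 * EX ^ 2) := by
    have h1 : (M⁻¹) ^ 2 * dirSq Nn F ≤ (M⁻¹) ^ 2 * (c₁ * (M ^ d / M ^ 2) * dirSq φ (periodBox (d := d) N)) :=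
      mul_le_mul_of_nonneg_left hR1 (by positivity)
    have h2 : (M⁻¹) ^ 2 * (c₁ * (M ^ d / M ^ 2) * dirSq φ (periodBox (d := d) N)) = c₁ * (M ^ d / M ^ 4 * dirSq φ (periodBox (d := d) N)) := by
      field_simp
    have h2' : c₂ * (M ^ d / M ^ 4) * dirSq φ (periodBox (d := d) N) = c₂ * (M ^ d / M ^ 4 * dirSq φ (periodBox (d := d) N)) := by ring
    have h3 : EN ^ 2 ≤ (c₁ + c₂) * (M ^ d / M ^ 4 * dirSq φ (periodBox (d := d) N)) := by
      rw [hENsq]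
      have h12 := add_le_add hR2 h1
      rw [h2, h2'] at h12
      linarith
    exact h3.trans (by nlinarith [hDL2, hc₁, hc₂])
  have hN1 : EN ≤ Real.sqrt (c₁ + c₂) * q₂ * EX := by
    have hr : 0 ≤ Real.sqrt (c₁ + c₂) * q₂ * EX := mul_nonneg (mul_nonneg (Real.sqrt_nonneg _) hq₂) hEX0
    have hs2 : Real.sqrt (c₁ + c₂) ^ 2 = c₁ + c₂ := Real.sq_sqrt (add_nonneg hc₁ hc₂)
    have hsq' : EN ^ 2 ≤ (Real.sqrt (c₁ + c₂) * q₂ * EX) ^ 2 := by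
      have e : (Real.sqrt (c₁ + c₂) * q₂ * EX) ^ 2 = Real.sqrt (c₁ + c₂) ^ 2 * (q₂ ^ 2 * EX ^ 2) := by ring
      rw [e, hs2]; exact hEN2
    exact (pow_le_pow_iff_left₀ hEN0 hr (by norm_num : (2 : ℕ) ≠ 0)).1 hsq'
  -- (DL1) ⇒ the ℓ¹-curl letter
  have hN2 : ε / M ^ 2 * (∑ p ∈ perWin d (N * L ^ (k + 1)), ‖curl Us Nn p‖) ≤ ε * c₃ * q₁ * EX ^ 2 := by
    have h1 : ε / M ^ 2 * (∑ p ∈ perWin d (N * L ^ (k + 1)), ‖curl Us Nn p‖)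
        ≤ ε / M ^ 2 * (c₃ * (M ^ d / M ^ 2) * dirL1 φ (periodBox (d := d) N)) := mul_le_mul_of_nonneg_left hR3 (by positivity)
    have h2 : ε / M ^ 2 * (c₃ * (M ^ d / M ^ 2) * dirL1 φ (periodBox (d := d) N)) = ε * c₃ * (M ^ d / M ^ 4 * dirL1 φ (periodBox (d := d) N)) := by
      field_simp
    rw [h2] at h1
    have h3 : ε * c₃ * (M ^ d / M ^ 4 * dirL1 φ (periodBox (d := d) N)) ≤ ε * c₃ * (q₁ * EX ^ 2) :=
      mul_le_mul_of_nonneg_left hDL1 (by positivity)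
    linarith
  refine ⟨u, X₀, fun y μ => X₀ y μ - Nn y μ, Nn, α₀, Real.sqrt (c₁ + c₂) * q₂, ε * c₃ * q₁, h.gauge.1, h.skew, ?_, h.hα₀, h.sup, h.rep,
    ?_, hTm, hNsk, by positivity, hN1, hN2, rfl, rfl, rfl⟩
  · exact h.per
  · funext y μ; simp only [Pi.add_apply, sub_add_cancel]

end

end Summit.QuantumFields.BalabanUV.T4Continuum.NE7RepWGaugeOfDecomposition
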